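import Summits.BirchSwinnertonDyer.BirchSwinnertonDyer.Theorems.ByReductionTypeAtTwoAdditiveKatoTransportSymmetry
import Summits.BirchSwinnertonDyer.BirchSwinnertonDyer.Theorems.ByReductionTypeAtTwoAdditiveKatoTransportPrintExact
import Summits.BirchSwinnertonDyer.BirchSwinnertonDyer.Theorems.ByReductionTypeAtTwoMultOddBranchFunctionalEquation
import HarnessLib

/-!
# Route ByReductionTypeAtTwo, crux `AdditivePotMultOverKAtTwo` (stmt-BirchSwinnertonDyer-22618; parent
# `AdditiveRankZeroAtTwo` 19098) — T20 (d) IN THE KERNEL, part 2: the four doors of the additive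
# `(−1)`-split-twist block (key `γ` and key `γ⁻¹`) with the functional-equation binder `hLtι : (ι L̃) = (L̃)` REMOVED

Cell `bsd-2adic`, seat `bsd-2adic-t42` GEN 21 (AP3-R2). Sequel of `ByReductionTypeAtTwoMultOddBranchFunctionalEquation`
(`MultOddBranchFE.map_invol_span_eq_of_eq_oddBranchMult_two_of_split`: Mazur–Tate–Teitelbaum §I.17 for the odd
branch at a split multiplicative `2`, PROVED, in the `Ideal.map (invol 2)` currency of the addL2x doors). HONEST FRAMING
(D-0036 / D-0054): theorems only; types-the-object-of; closes none; nothing booked; BSD is not proved by any of this.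
PARTITION: X5@2 additive, C4″ 22618 (−1)-split-twist block × p = 2.

Each door below is the addL2x GEN 16 door of the same name without `_fe`, with `hLtι` discharged by
`MultOddBranchFE.map_invol_span_eq_of_eq_oddBranchMult_two_of_split hsp hf hLt` — NO functional-equation hypothesis left:
* `lengthAt_selmerDual_le_of_oddBranchInputs_fe` (key `γ`, p682028: inputs `Kato2004.thm12_4` PRINT, the typed input
  `KatoOddBranchInputsAtTwoNegOneSplitTwist` T20 (b), `hXι : ι(char X) = char X` T20 (a), `L̃ = 2^m L⁻ ≠ 0`);
* `lengthAt_selmerDual_le_of_oddBranchInputs_of_decomposition_fe` (key `γ`, p682778: `hXι` replaced by the two Greenberg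
  Thm 1.14 PRINT facts + the decomposition reading `hdec` in length form);
* `lengthAt_selmerDualContra_le_of_oddBranchInputsPrintExact_fe`, `…_of_lengthAt_symm_fe` (key `γ⁻¹`, PRINT-EXACT home
  p683821: typed input `KatoOddBranchInputsAtTwoNegOneSplitTwistPrintExact`).

References: [MazurTateTeitelbaum1986Invent] §I.17; [Kato2004Asterisque] Thm. 12.4, 12.5 (3), §17.13; [GreenbergLNM1716]
Thm. 1.14; memo `run/shared/lean/pub/bsd-2adic/t42/DESIGN-T42-ADDENDUM-25.md`.
-/

set_option autoImplicit false
-- the summit's namespace `Summit.BirchSwinnertonDyer.BirchSwinnertonDyer` (Sub = Summit) trips `dupNamespace`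
set_option linter.dupNamespace false

noncomputable section

open scoped Classical MatrixGroups ModularForm NumberField

open Field CongruenceSubgroup PowerSeries WeierstrassCurve IsDedekindDomain
  Literature.NumberTheory.EllipticCurves Literature.NumberTheory.EllipticCurves.ModularForms
  Literature.NumberTheory.EllipticCurves.Module

namespace Summit.BirchSwinnertonDyer.BirchSwinnertonDyer.Theorems.MultOddBranchFE

/-! ## The door of the additive `(−1)`-split-twist block, functional equation discharged -/

section Door

/-- **T20 (e) with T20 (d) IN THE KERNEL**: `AddKatoTwo.lengthAt_selmerDual_le_of_oddBranchInputs_of_decomposition`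
(addL2x GEN 16) with its functional-equation binder
`hLtι : (Ideal.span {Lt}).map (invol 2).toRingHom = Ideal.span {Lt}` REMOVED — it follows from `hsp`, `hf`
and `hLt` (`map_invol_span_eq_of_eq_oddBranchMult_two_of_split`, Mazur–Tate–Teitelbaum §I.17 proved). All
other inputs displayed verbatim: `Kato2004.thm12_4` (PRINT), `KatoOddBranchInputsAtTwoNegOneSplitTwist` (T20 (b)),
`Greenberg1999_thm114_charIdeal_iota_invariant` / `…_splitMult_baseChange` (PRINT), the decomposition reading
`hdec` (T20 (a)), the integral multiple `Lt = 2^m L⁻ ≠ 0`.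
[cite: Kato2004Asterisque, Thm. 12.4 (2) (p. 221), Thm. 12.5 (3) and (12.5.1) (p. 222), §17.13 (pp. 279–280)]
[cite: GreenbergLNM1716, Thm. 1.14 (p. 68)] [cite: MazurTateTeitelbaum1986Invent, §I.17] -/
theorem lengthAt_selmerDual_le_of_oddBranchInputs_of_decomposition_fe (h12 : Kato2004.thm12_4)
    (hOB : AddKatoTwo.KatoOddBranchInputsAtTwoNegOneSplitTwist)
    (h114 : Greenberg1999_thm114_charIdeal_iota_invariant)
    (h114F : Greenberg1999.thm114_charIdeal_iota_invariant_splitMult_baseChange)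
    (W : WeierstrassCurve ℚ) [W.IsElliptic] [W.IsGloballyMinimal] [ContinuousSMul ℤ_[2] (W.tateModule 2)]
    {N : ℕ} [NeZero N] (f : CuspForm (Gamma0 N) 2) (κ : ZpExtension ℚ 2) (γ : absoluteGaloisGroup ℚ)
    (hsp : (W.quadraticTwist (-1)).HasSplitMultiplicativeReductionAtPrime 2)
    (hirr : W.HasIrreducibleModPGaloisRep 2) (hκ : κ.IsCyclotomic) (hγ : κ.IsTopGenerator γ)
    (hγ' : IsCyclotomicVariable 2 γ) (hf : IsNewformOf (W.quadraticTwist (-1)) f)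
    (I : Kato2004.IwasawaH1Data W 2 κ γ) (D : W.SelmerDualData κ γ)
    (W' : WeierstrassCurve ℚ) [W'.IsElliptic] [W'.IsGloballyMinimal] (hmult' : W'.HasMultiplicativeReductionAtPrime 2)
    (F : Type) [Field F] [NumberField F]
    (hF : ∀ v : HeightOneSpectrum (𝓞 F), (2 : 𝓞 F) ∈ v.asIdeal → (W'.baseChange F).HasSplitMultiplicativeReductionAt v)
    (κF : ZpExtension F 2) (γF : Field.absoluteGaloisGroup F) (hκF : κF.IsCyclotomic) (hγF : κF.IsTopGenerator γF)
    (DF : (W'.baseChange F).SelmerDualData κF γF) [Module.Finite (IwasawaAlgebra 2) DF.X] (hDF : DF.IsTorsion)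
    (D' : W'.SelmerDualData κ γ) [Module.Finite (IwasawaAlgebra 2) D'.X] (hD' : D'.IsTorsion)
    (hdec : ∀ 𝔮 : PrimeSpectrum (IwasawaAlgebra 2), 𝔮.asIdeal.height = 1 →
      PowerSeries.C (2 : ℤ_[2]) ∉ 𝔮.asIdeal →
      lengthAt (IwasawaAlgebra 2) DF.X 𝔮 = lengthAt (IwasawaAlgebra 2) D'.X 𝔮 + lengthAt (IwasawaAlgebra 2) D.X 𝔮)
    (Lt : IwasawaAlgebra 2) (m : ℕ)
    (hLt : iwasawaToPowerSeries 2 Lt =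
      PowerSeries.C ((2 : ℚ_[2]) ^ m) * padicLFunctionMinusBranchMult f (1 : ℚ_[2]) 1)
    (hLt0 : Lt ≠ 0)
    (𝔮 : PrimeSpectrum (IwasawaAlgebra 2)) (h𝔮 : 𝔮.asIdeal.height = 1)
    (hp𝔮 : PowerSeries.C (2 : ℤ_[2]) ∉ 𝔮.asIdeal) :
    lengthAt (IwasawaAlgebra 2) D.X 𝔮 ≤
      lengthAt (IwasawaAlgebra 2) (IwasawaAlgebra 2 ⧸ Ideal.span {Lt}) 𝔮 :=
  AddKatoTwo.lengthAt_selmerDual_le_of_oddBranchInputs_of_decomposition h12 hOB h114 h114F W f κ γ hsp hirr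
    hκ hγ hγ' hf I D W' hmult' F hF κF γF hκF hγF DF hDF D' hD' hdec Lt m hLt hLt0
    (map_invol_span_eq_of_eq_oddBranchMult_two_of_split hsp hf hLt) 𝔮 h𝔮 hp𝔮

/-- **Key-`γ` door (p682028) with T20 (d) IN THE KERNEL**: `AddKatoTwo.lengthAt_selmerDual_le_of_oddBranchInputs` with the
functional-equation binder `hLtι` REMOVED (discharged by `map_invol_span_eq_of_eq_oddBranchMult_two_of_split`). Displayed
inputs: `Kato2004.thm12_4` (PRINT), `KatoOddBranchInputsAtTwoNegOneSplitTwist` (T20 (b)), `hXι` (T20 (a)), `L̃ = 2^m L⁻ ≠ 0`.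
[cite: Kato2004Asterisque, Thm. 12.4 (2) (p. 221), Thm. 12.5 (3) and (12.5.1) (p. 222), §17.13 (pp. 279–280)]
[cite: MazurTateTeitelbaum1986Invent, §I.17] -/
theorem lengthAt_selmerDual_le_of_oddBranchInputs_fe (h12 : Kato2004.thm12_4)
    (hOB : AddKatoTwo.KatoOddBranchInputsAtTwoNegOneSplitTwist)
    (W : WeierstrassCurve ℚ) [W.IsElliptic] [W.IsGloballyMinimal] [ContinuousSMul ℤ_[2] (W.tateModule 2)]
    {N : ℕ} [NeZero N] (f : CuspForm (Gamma0 N) 2) (κ : ZpExtension ℚ 2) (γ : absoluteGaloisGroup ℚ)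
    (hsp : (W.quadraticTwist (-1)).HasSplitMultiplicativeReductionAtPrime 2)
    (hirr : W.HasIrreducibleModPGaloisRep 2) (hκ : κ.IsCyclotomic) (hγ : κ.IsTopGenerator γ)
    (hγ' : IsCyclotomicVariable 2 γ) (hf : IsNewformOf (W.quadraticTwist (-1)) f)
    (I : Kato2004.IwasawaH1Data W 2 κ γ) (D : W.SelmerDualData κ γ)
    (hXι : (charIdeal (IwasawaAlgebra 2) D.X).map (IwasawaAlgebra.invol 2).toRingHom =
      charIdeal (IwasawaAlgebra 2) D.X)
    (Lt : IwasawaAlgebra 2) (m : ℕ)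
    (hLt : iwasawaToPowerSeries 2 Lt =
      PowerSeries.C ((2 : ℚ_[2]) ^ m) * padicLFunctionMinusBranchMult f (1 : ℚ_[2]) 1)
    (hLt0 : Lt ≠ 0)
    (𝔮 : PrimeSpectrum (IwasawaAlgebra 2)) (h𝔮 : 𝔮.asIdeal.height = 1)
    (hp𝔮 : PowerSeries.C (2 : ℤ_[2]) ∉ 𝔮.asIdeal) :
    lengthAt (IwasawaAlgebra 2) D.X 𝔮 ≤
      lengthAt (IwasawaAlgebra 2) (IwasawaAlgebra 2 ⧸ Ideal.span {Lt}) 𝔮 :=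
  AddKatoTwo.lengthAt_selmerDual_le_of_oddBranchInputs h12 hOB W f κ γ hsp hirr hκ hγ hγ' hf I D hXι Lt m hLt hLt0
    (map_invol_span_eq_of_eq_oddBranchMult_two_of_split hsp hf hLt) 𝔮 h𝔮 hp𝔮

/-- **Key-`γ⁻¹` PRINT-EXACT door (p683821) with T20 (d) IN THE KERNEL**:
`AddKatoTwo.lengthAt_selmerDualContra_le_of_oddBranchInputsPrintExact` with `hLtι` REMOVED.
[cite: Kato2004Asterisque, Thm. 12.4 (2) (p. 221), Thm. 12.5 (3) and (12.5.1) (p. 222), §17.13 (pp. 279–280)]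
[cite: MazurTateTeitelbaum1986Invent, §I.17] -/
theorem lengthAt_selmerDualContra_le_of_oddBranchInputsPrintExact_fe (h12 : Kato2004.thm12_4)
    (hPE : AddKatoTwo.KatoOddBranchInputsAtTwoNegOneSplitTwistPrintExact)
    (W : WeierstrassCurve ℚ) [W.IsElliptic] [W.IsGloballyMinimal] [ContinuousSMul ℤ_[2] (W.tateModule 2)]
    {N : ℕ} [NeZero N] (f : CuspForm (Gamma0 N) 2) (κ : ZpExtension ℚ 2) (γ : absoluteGaloisGroup ℚ)
    (hsp : (W.quadraticTwist (-1)).HasSplitMultiplicativeReductionAtPrime 2)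
    (hirr : W.HasIrreducibleModPGaloisRep 2) (hκ : κ.IsCyclotomic) (hγ : κ.IsTopGenerator γ)
    (hγ' : IsCyclotomicVariable 2 γ) (hf : IsNewformOf (W.quadraticTwist (-1)) f)
    (I : Kato2004.IwasawaH1Data W 2 κ γ) (D' : W.SelmerDualData κ γ⁻¹) [Module.Finite (IwasawaAlgebra 2) D'.X]
    (hXι : (charIdeal (IwasawaAlgebra 2) D'.X).map (IwasawaAlgebra.invol 2).toRingHom =
      charIdeal (IwasawaAlgebra 2) D'.X)
    (Lt : IwasawaAlgebra 2) (m : ℕ)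
    (hLt : iwasawaToPowerSeries 2 Lt =
      PowerSeries.C ((2 : ℚ_[2]) ^ m) * padicLFunctionMinusBranchMult f (1 : ℚ_[2]) 1)
    (hLt0 : Lt ≠ 0)
    (𝔮 : PrimeSpectrum (IwasawaAlgebra 2)) (h𝔮 : 𝔮.asIdeal.height = 1)
    (hp𝔮 : PowerSeries.C (2 : ℤ_[2]) ∉ 𝔮.asIdeal) :
    lengthAt (IwasawaAlgebra 2) D'.X 𝔮 ≤
      lengthAt (IwasawaAlgebra 2) (IwasawaAlgebra 2 ⧸ Ideal.span {Lt}) 𝔮 :=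
  AddKatoTwo.lengthAt_selmerDualContra_le_of_oddBranchInputsPrintExact h12 hPE W f κ γ hsp hirr hκ hγ hγ' hf I D'
    hXι Lt m hLt hLt0 (map_invol_span_eq_of_eq_oddBranchMult_two_of_split hsp hf hLt) 𝔮 h𝔮 hp𝔮

/-- **Key-`γ⁻¹` PRINT-EXACT door, LENGTH form (p683821), with T20 (d) IN THE KERNEL**:
`AddKatoTwo.lengthAt_selmerDualContra_le_of_oddBranchInputsPrintExact_of_lengthAt_symm` with `hLtι` REMOVED.
[cite: Kato2004Asterisque, Thm. 12.5 (3) and (12.5.1) (p. 222), §17.13 (pp. 279–280)] [cite: MazurTateTeitelbaum1986Invent, §I.17] -/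
theorem lengthAt_selmerDualContra_le_of_oddBranchInputsPrintExact_of_lengthAt_symm_fe (h12 : Kato2004.thm12_4)
    (hPE : AddKatoTwo.KatoOddBranchInputsAtTwoNegOneSplitTwistPrintExact)
    (W : WeierstrassCurve ℚ) [W.IsElliptic] [W.IsGloballyMinimal] [ContinuousSMul ℤ_[2] (W.tateModule 2)]
    {N : ℕ} [NeZero N] (f : CuspForm (Gamma0 N) 2) (κ : ZpExtension ℚ 2) (γ : absoluteGaloisGroup ℚ)
    (hsp : (W.quadraticTwist (-1)).HasSplitMultiplicativeReductionAtPrime 2)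
    (hirr : W.HasIrreducibleModPGaloisRep 2) (hκ : κ.IsCyclotomic) (hγ : κ.IsTopGenerator γ)
    (hγ' : IsCyclotomicVariable 2 γ) (hf : IsNewformOf (W.quadraticTwist (-1)) f)
    (I : Kato2004.IwasawaH1Data W 2 κ γ) (D' : W.SelmerDualData κ γ⁻¹)
    (Lt : IwasawaAlgebra 2) (m : ℕ)
    (hLt : iwasawaToPowerSeries 2 Lt =
      PowerSeries.C ((2 : ℚ_[2]) ^ m) * padicLFunctionMinusBranchMult f (1 : ℚ_[2]) 1)
    (hLt0 : Lt ≠ 0)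
    (𝔮 : PrimeSpectrum (IwasawaAlgebra 2)) (h𝔮 : 𝔮.asIdeal.height = 1)
    (hp𝔮 : PowerSeries.C (2 : ℤ_[2]) ∉ 𝔮.asIdeal)
    (hXsym : lengthAt (IwasawaAlgebra 2) D'.X 𝔮 =
      lengthAt (IwasawaAlgebra 2) D'.X (PrimeSpectrum.comap (IwasawaAlgebra.invol 2).toRingHom 𝔮)) :
    lengthAt (IwasawaAlgebra 2) D'.X 𝔮 ≤
      lengthAt (IwasawaAlgebra 2) (IwasawaAlgebra 2 ⧸ Ideal.span {Lt}) 𝔮 :=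
  AddKatoTwo.lengthAt_selmerDualContra_le_of_oddBranchInputsPrintExact_of_lengthAt_symm h12 hPE W f κ γ hsp hirr hκ
    hγ hγ' hf I D' Lt m hLt hLt0 (map_invol_span_eq_of_eq_oddBranchMult_two_of_split hsp hf hLt) 𝔮 h𝔮 hp𝔮 hXsym

end Door

end Summit.BirchSwinnertonDyer.BirchSwinnertonDyer.Theorems.MultOddBranchFE

end
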